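import Summits.NavierStokesRegularity.NavierStokesRegularity.Theorems.ScaledTopAlignmentFlexibleZoom
import Summits.NavierStokesRegularity.NavierStokesRegularity.Theorems.ScaledTopAlignmentMostTimesWindowAt
import Summits.NavierStokesRegularity.NavierStokesRegularity.Theorems.ScaledTopAlignmentMostTimesEnd
import Summits.NavierStokesRegularity.NavierStokesRegularity.Theorems.LocalSineTubeDoorProfileAlignedWindowRigidity
import Summits.NavierStokesRegularity.NavierStokesRegularity.Theorems.SymmetryModuliCountLiouvilleKillsTypeI
import Summits.NavierStokesRegularity.NavierStokesRegularity.Theorems.IsobarTomographyTubeAlternativeStubTwoSidedVorticityRate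
import Summits.NavierStokesRegularity.NavierStokesRegularity.Theses.TypeILiouville
import Literature.Analysis.FluidPDE.VorticityCalculus
import HarnessLib
/-!
# Route `ScaledTopAlignment`: GLUE KIT for the NEAR-MAXIMUM MOST-TIMES window-bulk door — the door read
# only at points that are near-maximal BOTH at the Type-I rate (`κ/(T−t) ≤ |ω(t,x)|`) AND relative to the
# slice maximum (`q·|ω(t,x′)| ≤ |ω(t,x)|` for all `x′`), outside exceptional times of final density `≤ θ`
# (support for the deciding crux W3ʷᵇ = `AprioriWindowBulkAlignment`, stmt-NavierStokesRegularity-19447,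
# and its weakenings; no import of the route file)

Sibling of `ScaledTopAlignmentMostTimesGlueKit` (door W3ᵐᵗ of planner p3, MostTimes.lean l.46). The ONE
change: the window-bulk bound is demanded only at points `x` that are, in addition to the rate clause, a
`q`-fraction of the SLICE MAXIMUM of `|ω(t, ·)|` — the near-maximum notion of the cell's registered DNS
proxies (NEARMAX ladders: fractions of `max|ω|`), free of the blow-up time. The glue discharges the extra
premise at the preimages of the window's base point with the tree's UPPER TYPE-I VORTICITY LAW
`|ω(t, x′)| ≤ C/(T − t)` near `T` (`TubeAlternative.AnalyticPropagation.upper_vorticity_rate`, KNSS 2009 Prop. 4.1 (4.10) in the zoom frame):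
there `|ω| ≳ ν|Ω(y₀)|/λ_j² = |Ω(y₀)|(−s_j)/(T − t_j) ≥ (m|b|/C)·sup|ω(t_j)|`. Everything else is the
diagonal-over-levels argument of the sibling, run through the window lemma whose door is read only at the
preimages (`exists_window_cross_eq_zero_of_windowBulkAligned_at`).
Main: `false_of_nearMaxMostTimesBulkAligned_typeI`; bridges
`navierStokesRegularity_of_nearMaxMostTimesBulkAlignment_of_noTypeII` (door with `∃ θ < 1`) and
`navierStokesRegularity_of_nearMaxMostTimesBulkAlignment_half_of_noTypeII` (density `½`).
Door shape (per solution, after `∃ λ₀<1 ∃ R₀>0 [∃ θ<1]`):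
`∀ κ>0 ∀ q>0 ∀ ε>0 ∀ δ>0 ∃ M>0 ∃ E (final density ≤ θ·h) ∀ t ∈ [0,T) ∖ E ∀ x, M ≤ |ω(t,x)| →
κ/(T−t) ≤ |ω(t,x)| → (∀ x′, q|ω(t,x′)| ≤ |ω(t,x)|) → volume(misaligned λ₀-top part of the R₀ℓ-window) ≤ δℓ³`.
Dropping either near-maximum premise gives a STRONGER door, so W3ᵐᵗ (rate only) and the relative-only
door both imply this one.
WHAT THIS IS NOT: not NS regularity; nothing here proves any door; NoTypeII stays the residual hard core.
References: Giga–Miura, CMP 303 (2011) = HUPS #956, Thm 1.1, Rmk 1.4, §2.1 [GigaMiura2011]; KNSS, Acta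
Math. 203 (2009), Prop. 4.1, Thm 5.1, §6 [KochNadirashviliSereginSverak2009].
-/

noncomputable section
-- the summit and its single sub-problem share the name (CONVENTIONS §1), as in every Theorems file
set_option linter.dupNamespace false
open MeasureTheory Set Function Filter Topology Metric
open scoped RealInnerProductSpace ENNReal
namespace Summit.NavierStokesRegularity.NavierStokesRegularity.Theorems
open Literature.Analysis Literature.Analysis.FluidPDE
open Summit.NavierStokesRegularity.NavierStokesRegularity.Theorems.LocalSineTubeDoorProfileAlignedWindowRigidity

set_option maxHeartbeats 800000 in
/-- **A near-maximum most-times window-bulk door kills Type-I blow-up.** As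
`false_of_mostTimesWindowBulkAligned_typeI`, with the door demanded only at points that are near-maximal
both at the rate `κ/(T−t)` and relative to the slice maximum (`q|ω(t,x′)| ≤ |ω(t,x)|` for all `x′`), for
all `κ, q > 0`; the relative premise is discharged at the preimages of the window's base point by the upper
Type-I vorticity law `TubeAlternative.AnalyticPropagation.upper_vorticity_rate`. [cite: GigaMiura2011, Thm 1.1 with Rmk 1.4 and §2.1 (HUPS preprint #956 pp. 3–9)] -/
theorem false_of_nearMaxMostTimesBulkAligned_typeI {ν T : ℝ} (hν : 0 < ν) (hT : 0 < T)
    {u : ℝ → EuclideanSpace ℝ (Fin 3) → EuclideanSpace ℝ (Fin 3)} {p : ℝ → EuclideanSpace ℝ (Fin 3) → ℝ}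
    (hsol : IsClassicalNSSolutionOn (Ico 0 T) ν 0 u p) (hLH : IsLerayHopfOn T ν 0 (u 0) u)
    (hdec : HasRapidSpatialDecay (u 0))
    (hslab : ∀ T' < T, ∃ M : ℝ, ∀ t ∈ Icc 0 T', ∀ x, ‖u t x‖ ≤ M)
    (hI : IsTypeIBlowup u T) (hext : ¬ HasSmoothExtensionPast ν 0 u T)
    {lam0 R0 θ : ℝ} (hlam01 : lam0 < 1) (hR0 : 0 < R0) (hθ : θ < 1)
    (hW : ∀ κ : ℝ, 0 < κ → ∀ q : ℝ, 0 < q → ∀ ε : ℝ, 0 < ε → ∀ δ : ℝ, 0 < δ → ∃ M : ℝ, 0 < M ∧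
      ∃ E : Set ℝ, (∃ h0 : ℝ, 0 < h0 ∧ ∀ h : ℝ, 0 < h → h < h0 →
        volume (E ∩ Set.Ioo (T - h) T) ≤ ENNReal.ofReal (θ * h)) ∧
      ∀ t ∈ Set.Ico 0 T, t ∉ E → ∀ x : EuclideanSpace ℝ (Fin 3), M ≤ ‖curl (u t) x‖ →
        κ / (T - t) ≤ ‖curl (u t) x‖ → (∀ x' : EuclideanSpace ℝ (Fin 3), q * ‖curl (u t) x'‖ ≤ ‖curl (u t) x‖) →
          MeasureTheory.volume {y : EuclideanSpace ℝ (Fin 3) | lam0 * ‖curl (u t) x‖ ≤ ‖curl (u t) y‖ ∧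
              ‖x - y‖ ≤ R0 * Real.sqrt (ν / ‖curl (u t) x‖) ∧
              ε < Real.sqrt (1 - (inner ℝ (‖curl (u t) x‖⁻¹ • curl (u t) x)
                (‖curl (u t) y‖⁻¹ • curl (u t) y)) ^ 2)}
            ≤ ENNReal.ofReal (δ * Real.sqrt (ν / ‖curl (u t) x‖) ^ 3)) : False := by
  classical
  -- Step 1: the flexible zoom, base times `τ_j = T - T/(j+2)`
  set τ : ℕ → ℝ := fun j => T - T / ((j : ℝ) + 2) with hτdef
  have hτ : ∀ j, τ j ∈ Ico 0 T := fun j => by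
    have h2 : (0 : ℝ) < (j : ℝ) + 2 := by positivity
    have h3 : T / ((j : ℝ) + 2) ≤ T := by
      rw [div_le_iff₀ h2]; nlinarith [(Nat.cast_nonneg j : (0 : ℝ) ≤ j)]
    have h4 : 0 < T / ((j : ℝ) + 2) := div_pos hT h2
    simp only [hτdef, mem_Ico]
    constructor <;> linarith
  have hτT : Tendsto τ atTop (𝓝 T) := by
    have h1 : Tendsto (fun j : ℕ => T / ((j : ℝ) + 2)) atTop (𝓝 0) := by
      have h := (tendsto_one_div_add_atTop_nhds_zero_nat (𝕜 := ℝ)).comp (tendsto_add_atTop_nat 1)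
      have h' : Tendsto (fun j : ℕ => T * (1 / ((j : ℝ) + 2))) atTop (𝓝 (T * 0)) := by
        refine (h.congr fun j => ?_).const_mul T
        simp only [comp_apply, Nat.cast_add, Nat.cast_one]
        ring
      rw [mul_zero] at h'
      exact h'.congr fun j => by ring
    have h2 := h1.const_sub T
    rw [sub_zero] at h2
    exact h2
  obtain ⟨φ, -, C, W, xc, lam, hWcl, hW0, hlam, -, hlam0, -, hflex⟩ :=
    typeIZoom_ancientMild_limit_flexible hν hT hsol hLH hslab hI hext hτ hτT
  -- the upper Type-I law for the vorticity near `T`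
  obtain ⟨Cω, tω, htω, hCω⟩ := TubeAlternative.AnalyticPropagation.upper_vorticity_rate hν hT hsol hLH hdec hI
  set C' : ℝ := max Cω 1 with hC'def
  have hC' : 0 < C' := lt_of_lt_of_le one_pos (le_max_right _ _)
  have hCω' : ∀ t ∈ Ico tω T, ∀ x, ‖curl (u t) x‖ ≤ C' / (T - t) := fun t ht x =>
    (hCω t ht x).trans (div_le_div_of_nonneg_right (le_max_left _ _) (sub_pos.2 ht.2).le)
  -- Step 2: a non-unidirectional vorticity end `s < t₁` of `W`
  obtain ⟨t₁, ht₁, hend⟩ := exists_end_curl_not_unidirectional hWcl ⟨-1, by norm_num, 0, hW0⟩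
  have hnz : ∀ s < t₁, ∃ y, curl (W s) y ≠ 0 := by
    intro s hs
    by_contra h
    push Not at h
    have he1 : (EuclideanSpace.single (0 : Fin 3) (1 : ℝ) : EuclideanSpace ℝ (Fin 3)) ≠ 0 := by
      intro h0
      have := congr_arg (fun v : EuclideanSpace ℝ (Fin 3) => v 0) h0
      simp at this
    exact hend s hs ⟨EuclideanSpace.single 0 1, he1, fun y => ⟨0, by rw [h y, zero_smul]⟩⟩
  -- Step 3: the slice interval `[a, b]`, `b = 2 t₁`, `a = N b`, `N (1 - θ) = 3 - θ > 1`, and the floor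
  set b : ℝ := 2 * t₁ with hbdef
  have hb0 : b < 0 := by rw [hbdef]; linarith
  have hbt₁ : b < t₁ := by rw [hbdef]; linarith
  set B : ℝ := -b with hBdef
  have hB : 0 < B := by rw [hBdef]; linarith
  have h1θ : 0 < 1 - θ := by linarith
  set N : ℝ := 2 / (1 - θ) + 1 with hNdef
  have hN1 : 1 < N := by
    have : 0 < 2 / (1 - θ) := div_pos two_pos h1θ
    rw [hNdef]; linarith
  set a : ℝ := N * b with hadef
  have hab : a < b := by
    rw [hadef]; nlinarith
  have hθab : θ * (-a) < b - a := by
    have hNθ : N * (1 - θ) = 3 - θ := by rw [hNdef]; field_simp; ring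
    have e : b - a - θ * (-a) = B * (2 - θ) := by
      rw [hadef, hBdef]; linear_combination (-b) * hNθ
    nlinarith [mul_pos hB (show (0 : ℝ) < 2 - θ by linarith)]
  have hma : 0 < -a := by nlinarith
  have hIcc : ∀ s ∈ Icc a b, s < t₁ := fun s hs => lt_of_le_of_lt hs.2 hbt₁
  obtain ⟨m, hm, hfloor⟩ := exists_curl_floor_Icc hWcl hb0 fun s hs => hnz s (hIcc s hs)
  -- the door at `κ₀ = m B`, `q₀ = m B/(2C')`, along the levels `ε_n = δ_n = 1/(n+1)`
  set q₀ : ℝ := m * B / (2 * C') with hq₀def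
  have hq₀ : 0 < q₀ := by rw [hq₀def]; positivity
  have hlev : ∀ n : ℕ, ∃ M : ℝ, 0 < M ∧ ∃ E : Set ℝ, (∃ h0 : ℝ, 0 < h0 ∧ ∀ h : ℝ, 0 < h → h < h0 →
        volume (E ∩ Set.Ioo (T - h) T) ≤ ENNReal.ofReal (θ * h)) ∧
      ∀ t ∈ Set.Ico 0 T, t ∉ E → ∀ x : EuclideanSpace ℝ (Fin 3), M ≤ ‖curl (u t) x‖ →
        m * B / (T - t) ≤ ‖curl (u t) x‖ →
        (∀ x' : EuclideanSpace ℝ (Fin 3), q₀ * ‖curl (u t) x'‖ ≤ ‖curl (u t) x‖) →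
          volume {y : EuclideanSpace ℝ (Fin 3) | lam0 * ‖curl (u t) x‖ ≤ ‖curl (u t) y‖ ∧
              ‖x - y‖ ≤ R0 * Real.sqrt (ν / ‖curl (u t) x‖) ∧
              1 / ((n : ℝ) + 1) < Real.sqrt (1 - (inner ℝ (‖curl (u t) x‖⁻¹ • curl (u t) x)
                (‖curl (u t) y‖⁻¹ • curl (u t) y)) ^ 2)}
            ≤ ENNReal.ofReal (1 / ((n : ℝ) + 1) * Real.sqrt (ν / ‖curl (u t) x‖) ^ 3) :=
    fun n => hW (m * B) (mul_pos hm hB) q₀ hq₀ (1 / ((n : ℝ) + 1)) (by positivity) (1 / ((n : ℝ) + 1))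
      (by positivity)
  choose M hM0 E hEd hgoodn using hlev
  choose h0 hh0 hE using hEd
  -- Step 4a: the diagonal over levels, `P n j` = "scale `j` is admissible at level `n`"
  set P : ℕ → ℕ → Prop := fun n j =>
    lam j ^ 2 / ν * (-a) < min (h0 n) T ∧ M n * lam j ^ 2 * ((n : ℝ) + 1) ≤ 1 with hPdef
  have hPev : ∀ n, ∀ᶠ j in atTop, P n j := by
    intro n
    have h1 : Tendsto (fun j => lam j ^ 2 / ν * (-a)) atTop (𝓝 (0 ^ 2 / ν * (-a))) :=
      ((hlam0.pow 2).div_const ν).mul_const (-a)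
    rw [zero_pow two_ne_zero, zero_div, zero_mul] at h1
    have h2 : Tendsto (fun j => M n * lam j ^ 2 * ((n : ℝ) + 1)) atTop
        (𝓝 (M n * 0 ^ 2 * ((n : ℝ) + 1))) := ((hlam0.pow 2).const_mul (M n)).mul_const _
    rw [zero_pow two_ne_zero, mul_zero, zero_mul] at h2
    filter_upwards [h1.eventually_lt_const (lt_min (hh0 n) hT), h2.eventually_lt_const one_pos]
      with j hj1 hj2
    exact ⟨hj1, hj2.le⟩
  have hQev : ∀ n₀ : ℕ, ∀ᶠ j in atTop, ∀ n ∈ Iic n₀, P n j := fun n₀ =>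
    (eventually_all_finite (finite_Iic n₀)).2 fun n _ => hPev n
  set nsel : ℕ → ℕ := fun j => Nat.findGreatest (fun n => ∀ n' ∈ Iic n, P n' j) j with hnseldef
  have hnselP : ∀ᶠ j in atTop, P (nsel j) j := by
    filter_upwards [hQev 0] with j hj
    have hspec : ∀ n' ∈ Iic (nsel j), P n' j :=
      Nat.findGreatest_spec (P := fun n => ∀ n' ∈ Iic n, P n' j) (Nat.zero_le j) hj
    exact hspec (nsel j) (mem_Iic.2 le_rfl)
  have hnsel : Tendsto nsel atTop atTop := by
    refine tendsto_atTop.2 fun n₀ => ?_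
    filter_upwards [hQev n₀, eventually_ge_atTop n₀] with j hj hjn₀
    exact Nat.le_findGreatest (P := fun n => ∀ n' ∈ Iic n, P n' j) hjn₀ hj
  -- Step 4b: slice selection at every admissible scale, then a convergent subsequence
  have hμ : ∀ j, 0 < lam j ^ 2 / ν := fun j => div_pos (pow_pos (hlam j) 2) hν
  have hsel : ∀ j, ∃ s, s ∈ Icc a b ∧ (P (nsel j) j →
      T + lam j ^ 2 * s / ν ∉ E (nsel j) ∧ T + lam j ^ 2 * s / ν ∈ Ico 0 T) := by
    intro j
    by_cases hj : P (nsel j) j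
    · obtain ⟨s, hs, hsE⟩ := exists_slice_time_notMem (T := T) (hμ j) hab hb0 hθab (hE (nsel j))
        (lt_of_lt_of_le hj.1 (min_le_left _ _))
      have e : T + lam j ^ 2 / ν * s = T + lam j ^ 2 * s / ν := by ring
      refine ⟨s, Ioc_subset_Icc_self hs, fun _ => ⟨by rwa [e] at hsE, ?_, ?_⟩⟩
      · have h1 : lam j ^ 2 / ν * a ≤ lam j ^ 2 / ν * s := mul_le_mul_of_nonneg_left hs.1.le (hμ j).le
        have h2 : lam j ^ 2 / ν * (-a) ≤ T := (lt_of_lt_of_le hj.1 (min_le_right _ _)).le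
        rw [← e]; nlinarith
      · have h1 : lam j ^ 2 / ν * s < 0 := mul_neg_of_pos_of_neg (hμ j) (lt_of_le_of_lt hs.2 hb0)
        rw [← e]; linarith
    · exact ⟨b, right_mem_Icc.2 hab.le, fun h => absurd h hj⟩
  choose σ hσmem hσgood using hsel
  obtain ⟨sStar, hsStar, ψ, hψ, hσlim⟩ := isCompact_Icc.tendsto_subseq hσmem
  have hsStar0 : sStar < 0 := lt_of_le_of_lt hsStar.2 hb0
  obtain ⟨j₀, hj₀⟩ := eventually_atTop.1 hnselP
  -- the final index map `k i = ψ (i + j₀)` (so that `k i ≥ j₀`) and the levels `nsel (k i)`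
  set k : ℕ → ℕ := fun i => ψ (i + j₀) with hkdef
  have hk : StrictMono k := fun i i' h => hψ (Nat.add_lt_add_right h j₀)
  have hkj₀ : ∀ i, j₀ ≤ k i := fun i =>
    le_trans (Nat.le_add_left j₀ i) (hψ.id_le (i + j₀))
  have hPk : ∀ i, P (nsel (k i)) (k i) := fun i => hj₀ _ (hkj₀ i)
  have hgood : ∀ i, T + lam (k i) ^ 2 * σ (k i) / ν ∉ E (nsel (k i)) ∧
      T + lam (k i) ^ 2 * σ (k i) / ν ∈ Ico 0 T := fun i => hσgood (k i) (hPk i)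
  have hnk : Tendsto (fun i => nsel (k i)) atTop atTop := hnsel.comp hk.tendsto_atTop
  have hlev0 : Tendsto (fun i => 1 / ((nsel (k i) : ℝ) + 1)) atTop (𝓝 0) :=
    (tendsto_one_div_add_atTop_nhds_zero_nat (𝕜 := ℝ)).comp hnk
  have hσk : Tendsto (fun i => σ (k i)) atTop (𝓝 sStar) := hσlim.comp (tendsto_add_atTop_nat j₀)
  -- the selected times tend to `T`
  have htT : Tendsto (fun i => T + lam (k i) ^ 2 * σ (k i) / ν) atTop (𝓝 T) := by
    have h1 : Tendsto (fun i => T + lam (k i) ^ 2 * σ (k i) / ν) atTop (𝓝 (T + 0 ^ 2 * sStar / ν)) :=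
      ((((hlam0.comp hk.tendsto_atTop).pow 2).mul hσk).div_const ν).const_add T
    rw [zero_pow two_ne_zero, zero_mul, zero_div, add_zero] at h1
    exact h1
  -- diagonal convergence along `k` (extend the slices off the range of `k` by `s⋆`)
  set Ω : EuclideanSpace ℝ (Fin 3) → EuclideanSpace ℝ (Fin 3) := curl (W sStar) with hΩdef
  have hconv : ∀ y, Tendsto (fun i => (lam (k i) ^ 2 / ν) •
      curl (u (T + lam (k i) ^ 2 * σ (k i) / ν)) (xc (k i) + lam (k i) • y)) atTop (𝓝 (Ω y)) := by
    intro y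
    set σ' : ℕ → ℝ := Function.extend k (fun i => σ (k i)) fun _ => sStar with hσ'def
    have hσ' : Tendsto σ' atTop (𝓝 sStar) := tendsto_extend_of_strictMono hk hσk
    have h := (hflex sStar hsStar0 σ' hσ' y).comp hk.tendsto_atTop
    refine h.congr fun i => ?_
    simp only [comp_apply, hσ'def, hk.injective.extend_apply]
  -- Step 5: the window lemma (door read at the preimages of `y₀`), then rigidity
  obtain ⟨y₀, hy₀m⟩ := hfloor sStar hsStar
  have hy₀ : Ω y₀ ≠ 0 := by
    rw [hΩdef]; exact norm_pos_iff.1 (hm.trans hy₀m)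
  have hΩc : Continuous Ω :=
    continuous_curl ((hWcl.contDiff_slice hsStar0).of_le (by exact_mod_cast le_top))
  -- eventually the preimage of `y₀` carries vorticity `> ν m/λ²`, hence both near-maximum premises
  have hbig : ∀ᶠ i in atTop, m < ‖(lam (k i) ^ 2 / ν) •
      curl (u (T + lam (k i) ^ 2 * σ (k i) / ν)) (xc (k i) + lam (k i) • y₀)‖ :=
    (hconv y₀).norm.eventually_const_lt hy₀m
  have hlate : ∀ᶠ i in atTop, tω < T + lam (k i) ^ 2 * σ (k i) / ν := htT.eventually_const_lt htω.2
  have hWseq : ∀ ε : ℝ, 0 < ε → ∀ δ : ℝ, 0 < δ → ∃ Ms : ℕ → ℝ,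
      Tendsto (fun i => Ms i * lam (k i) ^ 2) atTop (𝓝 0) ∧ ∀ᶠ i in atTop,
      Ms i ≤ ‖curl (u (T + lam (k i) ^ 2 * σ (k i) / ν)) (xc (k i) + lam (k i) • y₀)‖ →
        volume {y : EuclideanSpace ℝ (Fin 3) |
            lam0 * ‖curl (u (T + lam (k i) ^ 2 * σ (k i) / ν)) (xc (k i) + lam (k i) • y₀)‖ ≤
              ‖curl (u (T + lam (k i) ^ 2 * σ (k i) / ν)) y‖ ∧
            ‖(xc (k i) + lam (k i) • y₀) - y‖ ≤
              R0 * Real.sqrt (ν / ‖curl (u (T + lam (k i) ^ 2 * σ (k i) / ν)) (xc (k i) + lam (k i) • y₀)‖) ∧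
            ε < Real.sqrt (1 - (inner ℝ
              (‖curl (u (T + lam (k i) ^ 2 * σ (k i) / ν)) (xc (k i) + lam (k i) • y₀)‖⁻¹ •
                curl (u (T + lam (k i) ^ 2 * σ (k i) / ν)) (xc (k i) + lam (k i) • y₀))
              (‖curl (u (T + lam (k i) ^ 2 * σ (k i) / ν)) y‖⁻¹ •
                curl (u (T + lam (k i) ^ 2 * σ (k i) / ν)) y)) ^ 2)}
          ≤ ENNReal.ofReal (δ * Real.sqrt (ν /
              ‖curl (u (T + lam (k i) ^ 2 * σ (k i) / ν)) (xc (k i) + lam (k i) • y₀)‖) ^ 3) := by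
    intro ε hε δ hδ
    refine ⟨fun i => M (nsel (k i)), ?_, ?_⟩
    · refine squeeze_zero (fun i => (mul_pos (hM0 _) (pow_pos (hlam _) 2)).le) (fun i => ?_) hlev0
      have hP2 := (hPk i).2
      have hn : (0 : ℝ) < (nsel (k i) : ℝ) + 1 := by positivity
      show M (nsel (k i)) * lam (k i) ^ 2 ≤ 1 / ((nsel (k i) : ℝ) + 1)
      rw [le_div_iff₀ hn]; exact hP2
    · filter_upwards [hlev0.eventually (Iic_mem_nhds hε), hlev0.eventually (Iic_mem_nhds hδ), hbig, hlate]
        with i hiε hiδ hib hil hMx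
      -- shorthand
      set tt : ℝ := T + lam (k i) ^ 2 * σ (k i) / ν with htt
      set Pt : EuclideanSpace ℝ (Fin 3) := xc (k i) + lam (k i) • y₀ with hPt
      have hTt : 0 < T - tt := sub_pos.2 (hgood i).2.2
      have hl2 : 0 < lam (k i) ^ 2 := pow_pos (hlam (k i)) 2
      have hTteq : T - tt = lam (k i) ^ 2 * (-σ (k i)) / ν := by rw [htt]; ring
      have hσB : B ≤ -σ (k i) := by rw [hBdef]; linarith [(hσmem (k i)).2]
      -- `m B < |ω(tt, Pt)| (T - tt)`
      have hωT : m * B < ‖curl (u tt) Pt‖ * (T - tt) := by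
        have h1 : m < lam (k i) ^ 2 / ν * ‖curl (u tt) Pt‖ := by
          have := hib
          rwa [norm_smul, Real.norm_of_nonneg (hμ (k i)).le] at this
        have h2 : lam (k i) ^ 2 / ν * ‖curl (u tt) Pt‖ * B ≤ ‖curl (u tt) Pt‖ * (T - tt) := by
          rw [hTteq]
          have : lam (k i) ^ 2 / ν * ‖curl (u tt) Pt‖ * B
              = ‖curl (u tt) Pt‖ * (lam (k i) ^ 2 * B / ν) := by ring
          rw [this]
          refine mul_le_mul_of_nonneg_left ?_ (norm_nonneg _)
          exact div_le_div_of_nonneg_right (mul_le_mul_of_nonneg_left hσB hl2.le) hν.le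
        nlinarith [mul_lt_mul_of_pos_right h1 hB]
      have hκ : m * B / (T - tt) ≤ ‖curl (u tt) Pt‖ := by
        rw [div_le_iff₀ hTt]; exact hωT.le
      have hq : ∀ x' : EuclideanSpace ℝ (Fin 3), q₀ * ‖curl (u tt) x'‖ ≤ ‖curl (u tt) Pt‖ := by
        intro x'
        have h1 : ‖curl (u tt) x'‖ ≤ C' / (T - tt) := hCω' tt ⟨hil.le, (hgood i).2.2⟩ x'
        have h2 : q₀ * (C' / (T - tt)) = m * B / 2 / (T - tt) := by
          rw [hq₀def]; field_simp
        calc q₀ * ‖curl (u tt) x'‖ ≤ q₀ * (C' / (T - tt)) := mul_le_mul_of_nonneg_left h1 hq₀.le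
          _ = m * B / 2 / (T - tt) := h2
          _ ≤ ‖curl (u tt) Pt‖ := by
              rw [div_le_iff₀ hTt]; nlinarith [mul_pos hm hB]
      have hbnd := hgoodn (nsel (k i)) tt (hgood i).2 (hgood i).1 Pt hMx hκ hq
      refine le_trans (measure_mono fun y hy => ?_) (le_trans hbnd (ENNReal.ofReal_le_ofReal ?_))
      · obtain ⟨h1, h2, h3⟩ := hy
        exact ⟨h1, h2, lt_of_le_of_lt hiε h3⟩
      · exact mul_le_mul_of_nonneg_right hiδ (pow_nonneg (Real.sqrt_nonneg _) 3)
  obtain ⟨U, hUo, hy₀U, hal⟩ := exists_window_cross_eq_zero_of_windowBulkAligned_at hν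
    (ω := fun t => curl (u t)) (t := fun i => T + lam (k i) ^ 2 * σ (k i) / ν)
    (xc := fun i => xc (k i)) (lam := fun i => lam (k i)) hlam01 hR0 (fun i => hlam (k i))
    hWseq hΩc hconv hy₀
  exact hW0 (eq_zero_of_aligned_window hWcl.hasTypeITimeDecay hWcl.continuousOn_uncurry
    (fun s t hst ht' x => hWcl.mild_eq_heatExtension hst ht' x) (fun t ht' => hWcl.isDivFree ht')
    hsStar0 hy₀ hUo ⟨y₀, hy₀U⟩ hal (-1) (by norm_num) 0)

/-- **Bridge: the near-maximum most-times window-bulk door plus NoTypeII gives Clay (A)** (door with a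
per-solution density fraction `θ < 1`; through `TypeILiouville.Assembly_holds`, the slab bound
`liouvilleKillsTypeI_exists_bound_Icc` and `false_of_nearMaxMostTimesBulkAligned_typeI`).
[cite: GigaMiura2011, Thm 1.1 with Rmk 1.4 and §2.1] -/
theorem navierStokesRegularity_of_nearMaxMostTimesBulkAlignment_of_noTypeII
    (hW : ∀ (ν T : ℝ), 0 < ν → 0 < T → ∀ (u : ℝ → EuclideanSpace ℝ (Fin 3) → EuclideanSpace ℝ (Fin 3))
      (p : ℝ → EuclideanSpace ℝ (Fin 3) → ℝ), IsClassicalNSSolutionOn (Set.Ico 0 T) ν 0 u p →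
      IsLerayHopfOn T ν 0 (u 0) u → HasRapidSpatialDecay (u 0) →
      ∃ lam0 : ℝ, lam0 < 1 ∧ ∃ R0 : ℝ, 0 < R0 ∧ ∃ θ : ℝ, θ < 1 ∧ ∀ κ : ℝ, 0 < κ → ∀ q : ℝ, 0 < q →
        ∀ ε : ℝ, 0 < ε → ∀ δ : ℝ, 0 < δ → ∃ M : ℝ, 0 < M ∧ ∃ E : Set ℝ,
        (∃ h0 : ℝ, 0 < h0 ∧ ∀ h : ℝ, 0 < h → h < h0 →
          MeasureTheory.volume (E ∩ Set.Ioo (T - h) T) ≤ ENNReal.ofReal (θ * h)) ∧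
        ∀ t ∈ Set.Ico 0 T, t ∉ E → ∀ x : EuclideanSpace ℝ (Fin 3), M ≤ ‖curl (u t) x‖ →
        κ / (T - t) ≤ ‖curl (u t) x‖ → (∀ x' : EuclideanSpace ℝ (Fin 3), q * ‖curl (u t) x'‖ ≤ ‖curl (u t) x‖) →
          MeasureTheory.volume {y : EuclideanSpace ℝ (Fin 3) | lam0 * ‖curl (u t) x‖ ≤ ‖curl (u t) y‖ ∧
              ‖x - y‖ ≤ R0 * Real.sqrt (ν / ‖curl (u t) x‖) ∧
              ε < Real.sqrt (1 - (inner ℝ (‖curl (u t) x‖⁻¹ • curl (u t) x)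
                (‖curl (u t) y‖⁻¹ • curl (u t) y)) ^ 2)}
            ≤ ENNReal.ofReal (δ * Real.sqrt (ν / ‖curl (u t) x‖) ^ 3))
    (hII : ∀ (ν T : ℝ), 0 < ν → 0 < T → ∀ (u : ℝ → EuclideanSpace ℝ (Fin 3) → EuclideanSpace ℝ (Fin 3))
      (p : ℝ → EuclideanSpace ℝ (Fin 3) → ℝ), IsMaximalSmoothSolution ν 0 u p T →
      IsLerayHopfOn T ν 0 (u 0) u → HasRapidSpatialDecay (u 0) → IsTypeIBlowup u T) :
    NavierStokesRegularity := by
  apply Summit.NavierStokesRegularity.NavierStokesRegularity.Theses.TypeILiouville.Assembly_holds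
  intro ν T hν hT u p hcl hLH hdec
  by_contra hext
  have hI : IsTypeIBlowup u T := hII ν T hν hT u p ⟨hcl, hext⟩ hLH hdec
  have hbdd : ∀ T' < T, ∃ M : ℝ, ∀ s ∈ Set.Icc 0 T', ∀ x, ‖u s x‖ ≤ M := by
    intro T' hT'
    by_cases h : 0 < T'
    · exact liouvilleKillsTypeI_exists_bound_Icc hν hcl hLH hdec ⟨h, hT'⟩
    · obtain ⟨M, hM⟩ := liouvilleKillsTypeI_exists_bound_Icc hν hcl hLH hdec (T' := T / 2)
        ⟨by linarith, by linarith⟩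
      push Not at h
      exact ⟨M, fun s hs x => hM s ⟨hs.1, by linarith [hs.2]⟩ x⟩
  obtain ⟨lam0, hlam01, R0, hR0, θ, hθ, hfam⟩ := hW ν T hν hT u p hcl hLH hdec
  exact false_of_nearMaxMostTimesBulkAligned_typeI hν hT hcl hLH hdec hbdd hI hext hlam01 hR0 hθ hfam

/-- **Bridge, density-½ form** of the near-maximum most-times door (no `θ`; `volume (E ∩ (T−h,T)) ≤ h/2`).
[folklore] -/
theorem navierStokesRegularity_of_nearMaxMostTimesBulkAlignment_half_of_noTypeII
    (hW : ∀ (ν T : ℝ), 0 < ν → 0 < T → ∀ (u : ℝ → EuclideanSpace ℝ (Fin 3) → EuclideanSpace ℝ (Fin 3))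
      (p : ℝ → EuclideanSpace ℝ (Fin 3) → ℝ), IsClassicalNSSolutionOn (Set.Ico 0 T) ν 0 u p →
      IsLerayHopfOn T ν 0 (u 0) u → HasRapidSpatialDecay (u 0) →
      ∃ lam0 : ℝ, lam0 < 1 ∧ ∃ R0 : ℝ, 0 < R0 ∧ ∀ κ : ℝ, 0 < κ → ∀ q : ℝ, 0 < q →
        ∀ ε : ℝ, 0 < ε → ∀ δ : ℝ, 0 < δ → ∃ M : ℝ, 0 < M ∧ ∃ E : Set ℝ,
        (∃ h0 : ℝ, 0 < h0 ∧ ∀ h : ℝ, 0 < h → h < h0 →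
          MeasureTheory.volume (E ∩ Set.Ioo (T - h) T) ≤ ENNReal.ofReal (h / 2)) ∧
        ∀ t ∈ Set.Ico 0 T, t ∉ E → ∀ x : EuclideanSpace ℝ (Fin 3), M ≤ ‖curl (u t) x‖ →
        κ / (T - t) ≤ ‖curl (u t) x‖ → (∀ x' : EuclideanSpace ℝ (Fin 3), q * ‖curl (u t) x'‖ ≤ ‖curl (u t) x‖) →
          MeasureTheory.volume {y : EuclideanSpace ℝ (Fin 3) | lam0 * ‖curl (u t) x‖ ≤ ‖curl (u t) y‖ ∧
              ‖x - y‖ ≤ R0 * Real.sqrt (ν / ‖curl (u t) x‖) ∧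
              ε < Real.sqrt (1 - (inner ℝ (‖curl (u t) x‖⁻¹ • curl (u t) x)
                (‖curl (u t) y‖⁻¹ • curl (u t) y)) ^ 2)}
            ≤ ENNReal.ofReal (δ * Real.sqrt (ν / ‖curl (u t) x‖) ^ 3))
    (hII : ∀ (ν T : ℝ), 0 < ν → 0 < T → ∀ (u : ℝ → EuclideanSpace ℝ (Fin 3) → EuclideanSpace ℝ (Fin 3))
      (p : ℝ → EuclideanSpace ℝ (Fin 3) → ℝ), IsMaximalSmoothSolution ν 0 u p T →
      IsLerayHopfOn T ν 0 (u 0) u → HasRapidSpatialDecay (u 0) → IsTypeIBlowup u T) :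
    NavierStokesRegularity := by
  refine navierStokesRegularity_of_nearMaxMostTimesBulkAlignment_of_noTypeII
    (fun ν T hν hT u p hcl hLH hdec => ?_) hII
  obtain ⟨lam0, hlam01, R0, hR0, hfam⟩ := hW ν T hν hT u p hcl hLH hdec
  refine ⟨lam0, hlam01, R0, hR0, 1 / 2, by norm_num, fun κ hκ q hq ε hε δ hδ => ?_⟩
  obtain ⟨M, hM0, E, ⟨h0, hh0, hE⟩, hM⟩ := hfam κ hκ q hq ε hε δ hδ
  exact ⟨M, hM0, E, ⟨h0, hh0, fun h hh hh0' => by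
    rw [show (1 : ℝ) / 2 * h = h / 2 by ring]; exact hE h hh hh0'⟩, hM⟩
end Summit.NavierStokesRegularity.NavierStokesRegularity.Theorems
end
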